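import Literature.Barriers.CriticalPhenomena.RigorousRGSmallParameterEpsilonVComparability
import HarnessLib

/-!
# `RigorousRGSmallParameter` (Slade, Theorem 1.4.1): the regularity parameters `ℓ_j`, `h_j`, the small
# parameter `ε_V(𝔥) = L^{dj}(¼n²|g|𝔥⁴ + ½n|ν|𝔥²)` and its size on `𝒟_j` at `𝔥 = ℓ_j, h_j`

Companion ("proof architecture") file of
`Literature/Barriers/CriticalPhenomena/RigorousRGSmallParameter.lean` (estimates layer behind
Theorem 6.3.1 / `Slade2017_prop822`): the parameter bookkeeping that feeds the stability estimates
(`…ExpStability`, `…StabilityIupper`) at Slade's two choices of `𝔥`. Slade §3.4: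
"`ℓ_j = ℓ₀L^{-½(d-α)j}L^{-α̂(j-j_m)₊}`"; §6.2.2: "`h_j = g̃^{-1/4}k₀L^{-½(d-α)j} = g̃^{-1/4}(k₀/ℓ₀)ℓ_j`
(`j ≤ j_m`). Since `g̃` is of order `ε`, `h_j` is much larger than `ℓ_j`"; §6.4.3:
"`ε_V = ε_V(𝔥_j) = L^{dj}(‖gτ_x²‖_{T_0(𝔥_j)} + ‖ντ_x‖_{T_0(𝔥_j)})` (6.46) … Computation gives
`ε_V ≍ |g|L^{dj}𝔥_j⁴ + |ν|L^{dj}𝔥_j²` (6.47)"; [BS-rg-IE] Proposition (prop:monobd):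
"`a k₀⁴ ≤ ε_{gτ²,j}(h_j)`, `ε_{V,j} ≤ A_L g̃_j` (`𝔥 = ℓ`), `A k₀` (`𝔥 = h`)". All PROVED here in
Slade's parametrisation (domain `𝒟_j` = tree `VDomain` with `ε = 2α - d`):

* `ellScale`, `hScale`, `ellScale_of_le`, `hScale_eq`, **`Ld_mul_ellScale_pow`**
  (`L^{dj}ℓ_j⁴ = ℓ₀⁴L^{(2α-d)j}`, `L^{dj}ℓ_j² = ℓ₀²L^{αj}`), **`Ld_mul_hScale_pow_four`** (`= k₀⁴g̃⁻¹L^{(2α-d)j}`);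
* `epsV` ((6.46)), `TphiNorm_const_mul_tau_sq_zero`, `TphiNorm_const_mul_tau_zero`, **`epsV_eq`**
  ((6.47) as an identity);
* `couplings_le_of_mem_VDomain`, **`epsV_ellScale_le`** (`ε_V(ℓ_j) ≤ (¼n²ℓ₀⁴+½nℓ₀²)C_𝒟s̄`),
  **`epsV_hScale_eq`**, **`epsV_hScale_bounds`** (`ε_{gτ²}(h_j) ≍ k₀⁴·s̄/g̃` two-sided).

Sources: G. Slade, arXiv:1611.06169, §3.4, §6.2.2, §6.3 ((6.36)–(6.37)), §6.4.3 ((6.46)–(6.47));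
D. C. Brydges, G. Slade [BS-rg-IE], arXiv:1403.7255, §1.3 and Proposition (prop:monobd) (§3.2).

## References

* [Slade2017] G. Slade, *Critical exponents for long-range O(n) models below the upper critical
  dimension*, Commun. Math. Phys. **358** (2018) 343–436, arXiv:1611.06169.
* [BrydgesSlade2015] D. C. Brydges, G. Slade, *A renormalisation group method. IV*, J. Stat.
  Phys. **159** (2015) 530–588, arXiv:1403.7255.
-/

noncomputable section

namespace Literature.Barriers.CriticalPhenomena

namespace LongRangePhi4

namespace LocalPoly

open Finset Tphi RGNorm Literature.Probability.LatticeModels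
open scoped ContDiff

variable {d M n : ℕ} [NeZero M]

/-! ### The parameters `ℓ_j`, `h_j` -/

/-- **Slade's `ℓ_j`** (display before Remark 3.4.1):
`ℓ_j = ℓ₀ L^{-½(d-α)j} L^{-α̂(j-j_m)₊}` — "an approximate measure of (an upper bound on) the size of
a typical Gaussian field with covariance `C_j`". [cite: Slade2017, §3.4 (display defining ℓ_j, before Remark 3.4.1)] -/
def ellScale (ℓ₀ L α αhat : ℝ) (d jm j : ℕ) : ℝ :=
  ℓ₀ * L ^ (-(2⁻¹ * ((d : ℝ) - α) * j)) * L ^ (-(αhat * ((j - jm : ℕ) : ℝ)))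

/-- **Slade's `h_j`** (§6.2.2): `h_j = g̃^{-1/4} k₀ L^{-½(d-α)j} = g̃^{-1/4}(k₀/ℓ₀)ℓ_j` for `j ≤ j_m`
("Since `g̃` is of order `ε`, `h_j` is much larger than `ℓ_j`"). [cite: Slade2017, §6.2.2 (display defining h_j)] -/
def hScale (k₀ gt L α : ℝ) (d j : ℕ) : ℝ := gt ^ (-(4 : ℝ)⁻¹) * k₀ * L ^ (-(2⁻¹ * ((d : ℝ) - α) * j))

omit [NeZero M] in
/-- Below the mass scale `ℓ_j = ℓ₀ L^{-½(d-α)j}`. [cite: Slade2017, §3.4 (cases display for ℓ_j, j ≤ j_m)] -/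
theorem ellScale_of_le {ℓ₀ L α αhat : ℝ} {d jm j : ℕ} (hj : j ≤ jm) :
    ellScale ℓ₀ L α αhat d jm j = ℓ₀ * L ^ (-(2⁻¹ * ((d : ℝ) - α) * j)) := by
  unfold ellScale
  rw [Nat.sub_eq_zero_of_le hj]
  simp

omit [NeZero M] in
/-- `h_j = g̃^{-1/4}(k₀/ℓ₀)ℓ_j` for `j ≤ j_m` (`ℓ₀ ≠ 0`). [cite: Slade2017, §6.2.2 (second form of h_j)] -/
theorem hScale_eq {k₀ gt L α ℓ₀ αhat : ℝ} (hℓ₀ : ℓ₀ ≠ 0) {d jm j : ℕ} (hj : j ≤ jm) :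
    hScale k₀ gt L α d j = gt ^ (-(4 : ℝ)⁻¹) * (k₀ / ℓ₀) * ellScale ℓ₀ L α αhat d jm j := by
  rw [ellScale_of_le hj]
  unfold hScale
  field_simp

omit [NeZero M] in
/-- **`L^{dj} ℓ_j⁴ = ℓ₀⁴ L^{(2α-d)j}`** and **`L^{dj} ℓ_j² = ℓ₀² L^{αj}`** below the mass scale: with
`ε = 2α - d`, `τ²` carries `L^{εj}` and `τ` carries `L^{αj}` — "`τ²` and `τ` are relevant below the
mass scale" (the exponents of (6.36)). [cite: Slade2017, §6.3 (sentence after (6.36))] -/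
theorem Ld_mul_ellScale_pow {ℓ₀ L α αhat : ℝ} (hL : 0 < L) {d jm j : ℕ} (hj : j ≤ jm) :
    L ^ ((d : ℝ) * j) * ellScale ℓ₀ L α αhat d jm j ^ 4 = ℓ₀ ^ 4 * L ^ ((2 * α - d) * j) ∧
    L ^ ((d : ℝ) * j) * ellScale ℓ₀ L α αhat d jm j ^ 2 = ℓ₀ ^ 2 * L ^ (α * j) := by
  rw [ellScale_of_le hj]
  have h4 : (L ^ (-(2⁻¹ * ((d : ℝ) - α) * j))) ^ 4 = L ^ (-(2 * ((d : ℝ) - α) * j)) := by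
    rw [← Real.rpow_natCast, ← Real.rpow_mul hL.le]; congr 1; push_cast; ring
  have h2 : (L ^ (-(2⁻¹ * ((d : ℝ) - α) * j))) ^ 2 = L ^ (-(((d : ℝ) - α) * j)) := by
    rw [← Real.rpow_natCast, ← Real.rpow_mul hL.le]; congr 1; push_cast; ring
  constructor
  · rw [mul_pow, h4, mul_left_comm, ← Real.rpow_add hL]
    congr 1; congr 1; ring
  · rw [mul_pow, h2, mul_left_comm, ← Real.rpow_add hL]
    congr 1; congr 1; ring

omit [NeZero M] in
/-- **`L^{dj} h_j⁴ = k₀⁴ g̃⁻¹ L^{(2α-d)j}`** (`g̃ > 0`). [cite: Slade2017, §6.2.2 (h_j)] -/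
theorem Ld_mul_hScale_pow_four {k₀ gt L α : ℝ} (hL : 0 < L) (hgt : 0 < gt) (d j : ℕ) :
    L ^ ((d : ℝ) * j) * hScale k₀ gt L α d j ^ 4 = k₀ ^ 4 * gt⁻¹ * L ^ ((2 * α - d) * j) := by
  unfold hScale
  have h4 : (L ^ (-(2⁻¹ * ((d : ℝ) - α) * j))) ^ 4 = L ^ (-(2 * ((d : ℝ) - α) * j)) := by
    rw [← Real.rpow_natCast, ← Real.rpow_mul hL.le]; congr 1; push_cast; ring
  have hg : (gt ^ (-(4 : ℝ)⁻¹)) ^ 4 = gt⁻¹ := by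
    rw [← Real.rpow_natCast, ← Real.rpow_mul hgt.le]
    norm_num
    exact Real.rpow_neg_one gt
  rw [mul_pow, mul_pow, h4, hg]
  rw [show gt⁻¹ * k₀ ^ 4 * L ^ (-(2 * ((d : ℝ) - α) * j)) = k₀ ^ 4 * gt⁻¹ * L ^ (-(2 * ((d : ℝ) - α) * j)) by ring,
    show L ^ ((d : ℝ) * j) * (k₀ ^ 4 * gt⁻¹ * L ^ (-(2 * ((d : ℝ) - α) * j))) =
      k₀ ^ 4 * gt⁻¹ * (L ^ ((d : ℝ) * j) * L ^ (-(2 * ((d : ℝ) - α) * j))) by ring, ← Real.rpow_add hL]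
  congr 2; ring

/-! ### The small parameter `ε_V(𝔥)` -/

/-- **Slade's small parameter `ε_V(𝔥) = L^{dj}(‖gτ_x²‖_{T_0(𝔥)} + ‖ντ_x‖_{T_0(𝔥)})`** ((6.46)), here
with `L^{dj} = |B|` written as a real parameter `Ld`. [cite: Slade2017, §6.4.3 (display (6.46))] -/
def epsV (Ld 𝔥 R : ℝ) (pΦ pN : ℕ) (g ν : ℝ) (x : TorusSite d M) : ℝ :=
  Ld * (TphiNorm pN (latticeFamily (unitStep d M) 𝔥 R pΦ) (basisDir d M n) (fun φ => g * (tau x φ * tau x φ)) 0 +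
    TphiNorm pN (latticeFamily (unitStep d M) 𝔥 R pΦ) (basisDir d M n) (fun φ => ν * tau x φ) 0)

/-- `‖cF‖_{T_0} = |c|‖F‖_{T_0}` for `F = τ_x²`: upper bound by `TphiNorm_const_mul_le`, lower bound by
the length-`4` dual test function. [folklore] -/
theorem TphiNorm_const_mul_tau_sq_zero {𝔥 R : ℝ} (h𝔥 : 0 < 𝔥) (hR : 0 < R) (pΦ : ℕ) {pN : ℕ} (hpN : 4 ≤ pN) (g : ℝ)
    (x : TorusSite d M) :
    TphiNorm pN (latticeFamily (unitStep d M) 𝔥 R pΦ) (basisDir d M n) (fun φ => g * (tau x φ * tau x φ)) 0 =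
      |g| * (4⁻¹ * (n : ℝ) ^ 2 * 𝔥 ^ 4) := by
  have hτ2 : ContDiff ℝ ∞ (fun φ => tau (d := d) (M := M) (n := n) x φ * tau x φ) := (contDiff_tau x).mul (contDiff_tau x)
  apply le_antisymm
  · refine (TphiNorm_const_mul_le h𝔥 hR pΦ pN g hτ2 0).trans ?_
    rw [TphiNorm_tau_sq_zero_eq h𝔥 hR pΦ hpN x]
  · have h := factorial_inv_mul_le_TphiNorm h𝔥 hR pΦ hpN (fun φ => g * (tau (n := n) x φ * tau x φ)) 0
    have e : sumSeq 4 (coeffFamily (basisDir d M n) (fun φ => g * (tau x φ * tau x φ)) 0) = g * (6 * (n : ℝ) ^ 2) := by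
      have h6 : sumSeq 4 (coeffFamily (basisDir d M n) (fun φ => tau x φ * tau x φ) 0) = 6 * (n : ℝ) ^ 2 := by
        rw [sumSeq_coeffFamily_tau_sq x 4, if_pos rfl]
      rw [← h6, ← sumSeq_mul_left]
      refine sumSeq_congr 4 fun z _ => ?_
      simp only [coeffFamily, coeff_const_mul _ hτ2 g z]
    rw [e] at h
    have e2 : ((Nat.factorial 4 : ℕ) : ℝ)⁻¹ * 𝔥 ^ 4 * |g * (6 * (n : ℝ) ^ 2)| = |g| * (4⁻¹ * (n : ℝ) ^ 2 * 𝔥 ^ 4) := by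
      rw [abs_mul, abs_of_nonneg (by positivity : (0:ℝ) ≤ 6 * (n : ℝ) ^ 2)]
      simp [Nat.factorial]; ring
    rwa [e2] at h

/-- `‖ντ_x‖_{T_0} = |ν|·½n𝔥²`. [folklore] -/
theorem TphiNorm_const_mul_tau_zero {𝔥 R : ℝ} (h𝔥 : 0 < 𝔥) (hR : 0 < R) (pΦ : ℕ) {pN : ℕ} (hpN : 2 ≤ pN) (ν : ℝ)
    (x : TorusSite d M) :
    TphiNorm pN (latticeFamily (unitStep d M) 𝔥 R pΦ) (basisDir d M n) (fun φ => ν * tau x φ) 0 = |ν| * (2⁻¹ * n * 𝔥 ^ 2) := by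
  apply le_antisymm
  · refine (TphiNorm_const_mul_le h𝔥 hR pΦ pN ν (contDiff_tau x) 0).trans ?_
    rw [TphiNorm_tau_zero_eq h𝔥 hR pΦ hpN x]
  · have h := factorial_inv_mul_le_TphiNorm h𝔥 hR pΦ hpN (fun φ => ν * tau (n := n) x φ) 0
    have e : sumSeq 2 (coeffFamily (basisDir d M n) (fun φ => ν * tau x φ) 0) = ν * (n : ℝ) := by
      rw [← sumSeq_two_coeffFamily_tau x, ← sumSeq_mul_left]
      refine sumSeq_congr 2 fun z _ => ?_
      simp only [coeffFamily, coeff_const_mul _ (contDiff_tau x) ν z]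
    rw [e] at h
    have e2 : ((Nat.factorial 2 : ℕ) : ℝ)⁻¹ * 𝔥 ^ 2 * |ν * (n : ℝ)| = |ν| * (2⁻¹ * n * 𝔥 ^ 2) := by
      rw [abs_mul, Nat.abs_cast]
      simp [Nat.factorial]; ring
    rwa [e2] at h

/-- **"Computation gives `ε_V ≍ |g|L^{dj}𝔥_j⁴ + |ν|L^{dj}𝔥_j²`"** ((6.47)) — exactly
`ε_V(𝔥) = L^{dj}(¼n²|g|𝔥⁴ + ½n|ν|𝔥²)` for the real `n`-component field (`p_𝒩 ≥ 4`). [cite: Slade2017, §6.4.3 (display (6.47))] -/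
theorem epsV_eq {𝔥 R : ℝ} (h𝔥 : 0 < 𝔥) (hR : 0 < R) (pΦ : ℕ) {pN : ℕ} (hpN : 4 ≤ pN) (Ld g ν : ℝ) (x : TorusSite d M) :
    epsV (n := n) Ld 𝔥 R pΦ pN g ν x = Ld * (|g| * (4⁻¹ * (n : ℝ) ^ 2 * 𝔥 ^ 4) + |ν| * (2⁻¹ * n * 𝔥 ^ 2)) := by
  unfold epsV
  rw [TphiNorm_const_mul_tau_sq_zero h𝔥 hR pΦ hpN g x, TphiNorm_const_mul_tau_zero h𝔥 hR pΦ (by omega) ν x]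

/-! ### `ε_V` on the domain `𝒟_j` -/

omit [NeZero M] in
/-- On `𝒟_j` (below the mass scale) the couplings obey `|g|L^{εj} ≤ C_𝒟 s̄` and `|ν|L^{αj} ≤ C_𝒟 s̄`
("`𝒟_j` requires `|g| ≤ C_𝒟 L^{-ε(j∧j_m)}` and `|ν| ≤ C_𝒟L^{-α(j∧j_m)}`"). [cite: Slade2017, §6.3 (sentence after (6.37))] -/
theorem couplings_le_of_mem_VDomain {L ε α CD sbar : ℝ} {d j jm : ℕ} (hj : j ≤ jm) {V : ℝ × ℝ}
    (hV : V ∈ VDomain L ε α d j jm CD sbar) :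
    |V.1| * L ^ (ε * j) ≤ CD * sbar ∧ |V.2| * L ^ (α * j) ≤ CD * sbar := by
  obtain ⟨hn, -⟩ := hV
  unfold VNorm at hn
  rw [min_eq_left hj] at hn
  exact ⟨(le_max_left _ _).trans hn, ((le_max_left _ _).trans (le_max_right _ _)).trans hn⟩

/-- **`ε_V(ℓ_j) ≤ (¼n²ℓ₀⁴ + ½nℓ₀²) C_𝒟 s̄` on `𝒟_j`, `j ≤ j_m`** (with `ε = 2α - d`): the analogue
of "[BS-rg-IE] (epVbardefz-app): `ε_{V,j} ≤ A_L g̃_j` for `𝔥 = ℓ`" in Slade's parametrisation.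
[cite: Slade2017, §6.4.3 ((6.46)–(6.47))] [cite: BrydgesSlade2015, Proposition (prop:monobd) (display (epVbardefz-app), case 𝔥 = ℓ)] -/
theorem epsV_ellScale_le {R : ℝ} (hR : 0 < R) (pΦ : ℕ) {pN : ℕ} (hpN : 4 ≤ pN) {ℓ₀ L α αhat CD sbar : ℝ}
    (hℓ₀ : 0 < ℓ₀) (hL : 0 < L) {jm j : ℕ} (hj : j ≤ jm) {V : ℝ × ℝ}
    (hV : V ∈ VDomain L (2 * α - d) α d j jm CD sbar) (x : TorusSite d M) :
    epsV (n := n) (L ^ ((d : ℝ) * j)) (ellScale ℓ₀ L α αhat d jm j) R pΦ pN V.1 V.2 x ≤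
      (4⁻¹ * (n : ℝ) ^ 2 * ℓ₀ ^ 4 + 2⁻¹ * n * ℓ₀ ^ 2) * (CD * sbar) := by
  have hℓ : 0 < ellScale ℓ₀ L α αhat d jm j := by
    rw [ellScale_of_le hj]; positivity
  rw [epsV_eq hℓ hR pΦ hpN]
  obtain ⟨h4, h2⟩ := Ld_mul_ellScale_pow (ℓ₀ := ℓ₀) (α := α) (αhat := αhat) hL hj (d := d)
  obtain ⟨hg, hν⟩ := couplings_le_of_mem_VDomain hj hV
  have e : L ^ ((d : ℝ) * j) * (|V.1| * (4⁻¹ * (n : ℝ) ^ 2 * ellScale ℓ₀ L α αhat d jm j ^ 4) +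
      |V.2| * (2⁻¹ * n * ellScale ℓ₀ L α αhat d jm j ^ 2)) =
      4⁻¹ * (n : ℝ) ^ 2 * ℓ₀ ^ 4 * (|V.1| * L ^ ((2 * α - d) * j)) + 2⁻¹ * n * ℓ₀ ^ 2 * (|V.2| * L ^ (α * j)) := by
    have e1 : L ^ ((d : ℝ) * j) * (|V.1| * (4⁻¹ * (n : ℝ) ^ 2 * ellScale ℓ₀ L α αhat d jm j ^ 4)) =
        4⁻¹ * (n : ℝ) ^ 2 * |V.1| * (L ^ ((d : ℝ) * j) * ellScale ℓ₀ L α αhat d jm j ^ 4) := by ring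
    have e2 : L ^ ((d : ℝ) * j) * (|V.2| * (2⁻¹ * n * ellScale ℓ₀ L α αhat d jm j ^ 2)) =
        2⁻¹ * n * |V.2| * (L ^ ((d : ℝ) * j) * ellScale ℓ₀ L α αhat d jm j ^ 2) := by ring
    rw [mul_add, e1, e2, h4, h2]; ring
  rw [e]
  have hA : 0 ≤ 4⁻¹ * (n : ℝ) ^ 2 * ℓ₀ ^ 4 := by positivity
  have hB : 0 ≤ 2⁻¹ * (n : ℝ) * ℓ₀ ^ 2 := by positivity
  nlinarith [mul_le_mul_of_nonneg_left hg hA, mul_le_mul_of_nonneg_left hν hB]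

/-- **`ε_{gτ²}(h_j) = ¼n²k₀⁴ · (gL^{εj})/g̃`** (exact), hence `≍ k₀⁴` on `𝒟_j` where
`C_𝒟⁻¹s̄ < gL^{εj} ≤ C_𝒟 s̄` and `g̃ ≍ s̄`: the analogue of "[BS-rg-IE] (epVbardefz-app):
`a k₀⁴ ≤ ε_{gτ²,j}(h_j)`", "`ε_{gτ²,j}(h_j) ≍ L^{dj}|g|h_j⁴ ≍ k₀⁴`". [cite: BrydgesSlade2015, §3.2 (displays (epVbarasymp)–(e:taunorm-h))] [cite: Slade2017, §6.2.2 (h_j), §6.4.3] -/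
theorem epsV_hScale_eq {R : ℝ} (hR : 0 < R) (pΦ : ℕ) {pN : ℕ} (hpN : 4 ≤ pN) {k₀ gt L α : ℝ} (hk₀ : 0 < k₀)
    (hgt : 0 < gt) (hL : 0 < L) (j : ℕ) (g : ℝ) (x : TorusSite d M) :
    epsV (n := n) (L ^ ((d : ℝ) * j)) (hScale k₀ gt L α d j) R pΦ pN g 0 x =
      4⁻¹ * (n : ℝ) ^ 2 * k₀ ^ 4 * (|g| * L ^ ((2 * α - d) * j)) * gt⁻¹ := by
  have hh : 0 < hScale k₀ gt L α d j := by unfold hScale; positivity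
  rw [epsV_eq hh hR pΦ hpN, abs_zero, zero_mul, add_zero]
  have h4 := Ld_mul_hScale_pow_four (k₀ := k₀) (α := α) hL hgt d j
  calc L ^ ((d : ℝ) * j) * (|g| * (4⁻¹ * (n : ℝ) ^ 2 * hScale k₀ gt L α d j ^ 4))
      = 4⁻¹ * (n : ℝ) ^ 2 * |g| * (L ^ ((d : ℝ) * j) * hScale k₀ gt L α d j ^ 4) := by ring
    _ = _ := by rw [h4]; ring

/-- **Two-sided bound `ε_{gτ²}(h_j) ≍ k₀⁴` on `𝒟_j`** (`j ≤ j_m`, `g̃ > 0`):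
`¼n²k₀⁴(C_𝒟 g̃)⁻¹ s̄ ≤ ε_{gτ²}(h_j) ≤ ¼n²k₀⁴ C_𝒟 s̄ g̃⁻¹`. [cite: BrydgesSlade2015, Proposition (prop:monobd) ((epVbardefz-app): a k₀⁴ ≤ ε_{gτ²,j}(h_j))] [cite: Slade2017, §6.4.3] -/
theorem epsV_hScale_bounds {R : ℝ} (hR : 0 < R) (pΦ : ℕ) {pN : ℕ} (hpN : 4 ≤ pN) {k₀ gt L α CD sbar : ℝ} (hk₀ : 0 < k₀)
    (hgt : 0 < gt) (hL : 0 < L) {jm j : ℕ} (hj : j ≤ jm) {V : ℝ × ℝ}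
    (hV : V ∈ VDomain L (2 * α - d) α d j jm CD sbar) (x : TorusSite d M) :
    4⁻¹ * (n : ℝ) ^ 2 * k₀ ^ 4 * (CD⁻¹ * sbar) * gt⁻¹ ≤ epsV (n := n) (L ^ ((d : ℝ) * j)) (hScale k₀ gt L α d j) R pΦ pN V.1 0 x ∧
    epsV (n := n) (L ^ ((d : ℝ) * j)) (hScale k₀ gt L α d j) R pΦ pN V.1 0 x ≤ 4⁻¹ * (n : ℝ) ^ 2 * k₀ ^ 4 * (CD * sbar) * gt⁻¹ := by
  rw [epsV_hScale_eq hR pΦ hpN hk₀ hgt hL j V.1 x]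
  obtain ⟨hg, -⟩ := couplings_le_of_mem_VDomain hj hV
  have hlow : CD⁻¹ * sbar ≤ |V.1| * L ^ ((2 * α - d) * j) := by
    obtain ⟨-, hV2⟩ := hV
    rw [min_eq_left hj] at hV2
    have hLp : 0 < L ^ ((2 * α - (d : ℝ)) * j) := Real.rpow_pos_of_pos hL _
    have e : CD⁻¹ * L ^ (-((2 * α - (d : ℝ)) * j)) * sbar * L ^ ((2 * α - (d : ℝ)) * j) = CD⁻¹ * sbar := by
      rw [Real.rpow_neg hL.le]; field_simp
    calc CD⁻¹ * sbar = CD⁻¹ * L ^ (-((2 * α - (d : ℝ)) * j)) * sbar * L ^ ((2 * α - (d : ℝ)) * j) := e.symm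
      _ ≤ V.1 * L ^ ((2 * α - (d : ℝ)) * j) := mul_le_mul_of_nonneg_right hV2.le hLp.le
      _ ≤ |V.1| * L ^ ((2 * α - (d : ℝ)) * j) := mul_le_mul_of_nonneg_right (le_abs_self _) hLp.le
  have hc : 0 ≤ 4⁻¹ * (n : ℝ) ^ 2 * k₀ ^ 4 := by positivity
  have hgi : 0 ≤ gt⁻¹ := inv_nonneg.2 hgt.le
  constructor
  · exact mul_le_mul_of_nonneg_right (mul_le_mul_of_nonneg_left hlow hc) hgi
  · exact mul_le_mul_of_nonneg_right (mul_le_mul_of_nonneg_left hg hc) hgi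

end LocalPoly

end LongRangePhi4

end Literature.Barriers.CriticalPhenomena
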